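import Literature.Geometry.Lorentzian.GeodesicContinuousDependence
import HarnessLib

/-!
# Smooth dependence of geodesics on their initial data (the local geodesic flow is `C^k`)

Sequel of `Literature.Geometry.Lorentzian.GeodesicContinuousDependence` (continuity of the geodesic
flow). For a covariant derivative `cov` of class `C^k`, `1 ≤ k < ∞`, on the tangent bundle of a
Hausdorff manifold `M` (finite-dimensional complete model space), every `p₀ ∈ TM` over an
interior point has an open neighbourhood `𝒰` and an `ε > 0` with a family `Γ p` of geodesics on
`(-ε, ε)`, `tangentLift (Γ p) 0 = p` (`p ∈ 𝒰`), such that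
`(p, t) ↦ tangentLift (Γ p) t : TM × ℝ → TM` is **of class `C^k` on `𝒰 × (-ε, ε)`**
(`exists_nhds_contMDiffOn_isGeodesicOn`): O'Neill, *Semi-Riemannian geometry* (1983), Ch. 3,
Lemma 22 with the differentiable dependence of solutions of ordinary differential equations on
initial conditions ("standard", remark before Prop. 28, p. 70), i.e. Lee, *Introduction to
Riemannian Manifolds* (2018), Thm. 4.27 (d) / Prop. 5.19 (the geodesic flow and the exponential
map are smooth). Proof: the Christoffel data of a `C^k` connection read in a chart are `C^k`
(`exists_christoffelChart_contMDiff`, the `C^k` version of the tree's `exists_christoffelChart`),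
so the first-order geodesic system in the chart at `π p₀` is `C^k` and its local flow is `C^k`
jointly in the initial value and the time (`Literature.Analysis.ODE.exists_contDiffOn_flow`, Lang
1995, IV §1, Thm. 1.14); chart solutions are geodesics (`isGeodesicOn_of_chartSolution`), and read
in the extended charts of `TM × ℝ` at `(p₀, 0)` and of `TM` at `p₀` the family IS that flow
(`contMDiffOn_iff_of_subset_source'`). By uniqueness the family agrees with the maximal geodesics,
whence `C^k`-smoothness of `(p, t) ↦ (γ_p t, γ_p' t)` near `(p₀, t)` for small `|t|` for a complete
connection (`exists_isOpen_contMDiffOn_tangentLift_maximalGeodesic`).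

For complete connections (of class `C^k` and `C¹`): `exists_isOpen_contMDiffOn_tangentLift_maximalGeodesic`
(local joint `C^k`-smoothness of `(p, t) ↦ (γ_p t, γ_p' t)`),
`exists_isOpen_forall_contMDiffAt_tangentLift_maximalGeodesic`, and — on a compact flow-invariant
set, e.g. a sphere bundle of a compact Riemannian manifold — `C^k`-smoothness of the time-`t`
maps for ALL `t` (`contMDiffAt_tangentLift_maximalGeodesic_of_isCompact`, the iterate argument of
`GeodesicContinuousDependence` run with `ContMDiffAt`; base-point form
`contMDiffAt_maximalGeodesic_of_isCompact`).

Consequence for the exponential map (`ExponentialMap.lean`): `contMDiffAt_expMap_of_isCompact` —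
`w ↦ exp_x(w)` is `C^k` at every `v` with `(x, v)` in a compact flow-invariant set (Lee 2018,
Prop. 5.19 in that generality; on a compact Riemannian manifold every vector qualifies), with the
smooth fibre inclusion `contMDiff_totalSpaceMk`.

Everything is proved; no named facts. Not here: joint smoothness at all times, smoothness of `exp`
at vectors outside compact invariant sets and openness of its domain.

## References

* B. O'Neill, *Semi-Riemannian geometry with applications to relativity*, Academic Press 1983,
  Ch. 3, Lemma 22 (p. 68), remark before Prop. 28 (p. 70). [ONeill1983]
* J. M. Lee, *Introduction to Riemannian Manifolds*, 2nd ed., GTM 176 (2018), Thm. 4.27 (d),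
  Prop. 5.19. [LeeRiemannianManifolds2018]
* S. Lang, *Differential and Riemannian Manifolds*, GTM 160 (1995), Ch. IV §1, Thm. 1.14.
  [Lang1995]
-/

noncomputable section

open Bundle Set Filter Metric
open scoped Manifold ContDiff Topology NNReal

namespace Literature.Geometry.Lorentzian

variable {E : Type*} [NormedAddCommGroup E] [NormedSpace ℝ E] {H : Type*} [TopologicalSpace H]
  {I : ModelWithCorners ℝ E H} {M : Type*} [TopologicalSpace M] [ChartedSpace H M]
  [IsManifold I ∞ M] [FiniteDimensional ℝ E]
  {cov : CovariantDerivative I E (TangentSpace I : M → Type _)}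

/-! ### `C^k` Christoffel data in a chart -/

/-- **`C^k` Christoffel data in a chart** (the `C^k` version of the tree's
`exists_christoffelChart`, O'Neill 1983, Ch. 3, proof of Lemma 22): for a `C^k` connection on a
Hausdorff manifold and a point `x₁` there are an open neighbourhood `N` of `x₁` inside the chart
domain of `x₁` and maps `Ĉᵢ : M → (E →L[ℝ] E)`, `C^k` at `x₁`, reading `w ↦ ∇_w sᵢ` in the
trivialisation at `x₁` for the coordinate frame `sᵢ` of the chart at `x₁` at every point of `N`
(same construction: globalise `sᵢ` with a bump function, apply the `C^k` hypothesis to the smooth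
global sections, read the `C^k` section of `Hom(TM, TM)` in the trivialisation at `x₁`, and use
locality of `∇`). [cite: ONeill1983, Ch. 3, Lemma 22] -/
theorem exists_christoffelChart_contMDiff [T2Space M] (k : ℕ)
    [CovariantDerivative.ContMDiffCovariantDerivative cov k]
    {ι : Type*} [Fintype ι] (b : Module.Basis ι ℝ E) (x₁ : M) :
    ∃ (N : Set M) (Ĉ : ι → M → (E →L[ℝ] E)), IsOpen N ∧ x₁ ∈ N ∧ N ⊆ (chartAt H x₁).source ∧
      (∀ y ∈ N, ∀ (i) (w : TangentSpace I y),
        Ĉ i y ((trivializationAt E (TangentSpace I) x₁).continuousLinearMapAt ℝ y w) =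
          (trivializationAt E (TangentSpace I) x₁
            ⟨y, cov ((trivializationAt E (TangentSpace I) x₁).localFrame b i) y w⟩).2) ∧
      ∀ i, ContMDiffAt I 𝓘(ℝ, E →L[ℝ] E) k (Ĉ i) x₁ := by
  obtain ⟨ψ⟩ : Nonempty (SmoothBumpFunction I x₁) := inferInstance
  set e₁ := trivializationAt E (TangentSpace I : M → Type _) x₁ with he₁_def
  set σ : ι → Π y : M, TangentSpace I y := fun i ↦ (ψ : M → ℝ) • e₁.localFrame b i with hσ_def
  have hσ : ∀ i, CMDiff ∞ (T% (σ i)) := fun i ↦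
    ContMDiffOn.smul_section_of_tsupport ψ.contMDiff.contMDiffOn (chartAt H x₁).open_source
      ψ.tsupport_subset_chartAt_source (e₁.contMDiffOn_localFrame_baseSet ∞ b i)
  set N : Set M :=
    (chartAt H x₁).source ∩ extChartAt I x₁ ⁻¹' Metric.ball (extChartAt I x₁ x₁) ψ.rIn with hN_def
  have hN : IsOpen N := by
    have h := (continuousOn_extChartAt (I := I) x₁).isOpen_inter_preimage
      (isOpen_extChartAt_source x₁) (Metric.isOpen_ball (x := extChartAt I x₁ x₁) (ε := ψ.rIn))
    simpa only [extChartAt_source] using h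
  have hx₁ : x₁ ∈ N := ⟨mem_chart_source H x₁, by simp [ψ.rIn_pos]⟩
  have hNs : N ⊆ (chartAt H x₁).source := inter_subset_left
  have hψN : ∀ y ∈ N, (ψ : M → ℝ) =ᶠ[𝓝 y] 1 := fun y hy ↦
    ψ.eventuallyEq_one_of_dist_lt hy.1 (by simpa using hy.2)
  have hcov : ∀ y ∈ N, ∀ i, cov (σ i) y = cov (e₁.localFrame b i) y := by
    intro y hy i
    refine cov.isCovariantDerivativeOn.congr_of_eventuallyEq (s := univ)
      ((hσ i).contMDiffAt.mdifferentiableAt (by simp))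
      ((contMDiffAt_localFrame_of_mem 1 e₁ b i (hNs hy)).mdifferentiableAt one_ne_zero)
      univ_mem ?_
    filter_upwards [hψN y hy] with y' hy'
    simp [hσ_def, hy']
  refine ⟨N, fun i y ↦ ContinuousLinearMap.inCoordinates E (TangentSpace I : M → Type _) E
    (TangentSpace I : M → Type _) x₁ y x₁ y (cov (σ i) y), hN, hx₁, hNs, ?_, ?_⟩
  · intro y hy i w
    have hye : y ∈ e₁.baseSet := by simpa [he₁_def] using hNs hy
    beta_reduce
    rw [ContinuousLinearMap.inCoordinates_eq hye hye]
    simp only [ContinuousLinearMap.coe_comp, Function.comp_apply, ContinuousLinearEquiv.coe_coe,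
      Trivialization.symm_continuousLinearEquivAt_eq, Trivialization.coe_continuousLinearEquivAt_eq]
    rw [Trivialization.symmL_continuousLinearMapAt _ hye, hcov y hy i,
      Trivialization.continuousLinearMapAt_apply_of_mem ℝ _ hye]
  · intro i
    have h1 : ContMDiffOn I (I.prod 𝓘(ℝ, E →L[ℝ] E)) k
        (fun y ↦ (⟨y, cov (σ i) y⟩ :
          TotalSpace (E →L[ℝ] E) (fun y : M ↦ TangentSpace I y →L[ℝ] TangentSpace I y))) univ :=
      CovariantDerivative.ContMDiffCovariantDerivative.contMDiff.contMDiff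
        ((hσ i).of_le (WithTop.coe_le_coe.2 le_top)).contMDiffOn
    exact ((contMDiffAt_hom_bundle _).1 (h1.contMDiffAt univ_mem)).2

/-! ### The local geodesic flow is `C^k` -/

/-- **Geodesics depend `C^k`-smoothly on their initial data, locally** (O'Neill 1983, Ch. 3,
Lemma 22 with the differentiable dependence of ODE solutions on initial conditions, p. 70; Lee
2018, Thm. 4.27 (d) / Prop. 5.19). For a connection of class `C^k`, `1 ≤ k < ∞`, on a Hausdorff
manifold and `p₀ ∈ TM` over an interior point there are an open `𝒰 ∋ p₀` in `TM`, an `ε > 0` and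
curves `Γ p` such that every `Γ p`, `p ∈ 𝒰`, is a geodesic on `(-ε, ε)` with
`tangentLift (Γ p) 0 = p`, and `(p, t) ↦ tangentLift (Γ p) t ∈ TM` is of class `C^k` on
`𝒰 × (-ε, ε)` (as a map of manifolds `TM × ℝ → TM`). Proof: the geodesic system in the chart at
`π p₀` is `C^k` near `(φ π p₀, (p₀)_φ)` (`exists_christoffelChart_contMDiff`), so its local flow is
jointly `C^k` (`Literature.Analysis.ODE.exists_contDiffOn_flow`); its solutions are geodesics whose
tangent lifts read `(u, w)` in the trivialisation at `π p₀` (`isGeodesicOn_of_chartSolution`),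
i.e. in the extended chart of `TM` at `p₀` the family is the flow itself.
[cite: ONeill1983, Ch. 3, Lemma 22 and p. 70] -/
theorem exists_nhds_contMDiffOn_isGeodesicOn [CompleteSpace E] [T2Space M] (k : ℕ) (hk : 1 ≤ k)
    [CovariantDerivative.ContMDiffCovariantDerivative cov k]
    (p₀ : TangentBundle I M) (hx : I.IsInteriorPoint p₀.proj) :
    ∃ 𝒰 : Set (TangentBundle I M), IsOpen 𝒰 ∧ p₀ ∈ 𝒰 ∧ ∃ ε > (0 : ℝ),
      ∃ Γ : TangentBundle I M → ℝ → M,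
      (∀ p ∈ 𝒰, IsGeodesicOn cov (Γ p) (Ioo (-ε) ε) ∧ tangentLift I (Γ p) 0 = p) ∧
      ContMDiffOn (I.tangent.prod 𝓘(ℝ, ℝ)) I.tangent k
        (fun q : TangentBundle I M × ℝ ↦ tangentLift I (Γ q.1) q.2) (𝒰 ×ˢ Ioo (-ε) ε) := by
  set x₁ := p₀.proj with hx₁_def
  set b := Module.finBasis ℝ E with hb_def
  obtain ⟨N, Ĉ, hN, hxN, hNs, hĈ, hĈs⟩ := exists_christoffelChart_contMDiff (cov := cov) k b x₁
  set φ := extChartAt I x₁ with hφ_def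
  set e₁ := trivializationAt E (TangentSpace I : M → Type _) x₁ with he₁_def
  -- shrink `N` so that the Christoffel data are `C^k` at every point of it
  have hĈn : ∀ i, ∀ᶠ y in 𝓝 x₁, ContMDiffAt I 𝓘(ℝ, E →L[ℝ] E) k (Ĉ i) y := fun i ↦
    (contMDiffAt_iff_contMDiffAt_nhds (by exact_mod_cast WithTop.coe_ne_top)).1 (hĈs i)
  obtain ⟨N₁, hN₁N, hN₁o, hxN₁, hN₁Ĉ⟩ : ∃ N₁ ⊆ N, IsOpen N₁ ∧ x₁ ∈ N₁ ∧
      ∀ y ∈ N₁, ∀ i, ContMDiffAt I 𝓘(ℝ, E →L[ℝ] E) k (Ĉ i) y := by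
    have h : ∀ᶠ y in 𝓝 x₁, y ∈ N ∧ ∀ i, ContMDiffAt I 𝓘(ℝ, E →L[ℝ] E) k (Ĉ i) y :=
      Filter.Eventually.and (hN.mem_nhds hxN) (eventually_all.2 hĈn)
    obtain ⟨N₁, hN₁, hN₁o, hxN₁⟩ := eventually_nhds_iff.1 h
    exact ⟨N₁, fun y hy ↦ (hN₁ y hy).1, hN₁o, hxN₁, fun y hy ↦ (hN₁ y hy).2⟩
  obtain ⟨O, hO, hxO, hOt, hON, hOr⟩ := exists_chartBall hx hN₁o hxN₁
  -- the first-order system, `C^k` on `O × E`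
  set G : E × E → E := fun pq ↦ -∑ i, b.repr pq.2 i • Ĉ i (φ.symm pq.1) pq.2 with hG_def
  set F : E × E → E × E := fun pq ↦ (pq.2, G pq) with hF_def
  have hF : ∀ z ∈ O, ∀ q : E, ContDiffAt ℝ k F (z, q) := by
    intro z hz q
    have hG : ContDiffAt ℝ k G (z, q) := by
      have h1 : ∀ i, ContDiffAt ℝ k (fun pq : E × E ↦ Ĉ i (φ.symm pq.1)) (z, q) := by
        intro i
        have h2 : ContMDiffWithinAt 𝓘(ℝ, E) 𝓘(ℝ, E →L[ℝ] E) k (Ĉ i ∘ φ.symm) (range I) z := by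
          refine ContMDiffAt.comp_contMDiffWithinAt _ ?_
            (contMDiffWithinAt_extChartAt_symm_range x₁ (hOt hz))
          exact hN₁Ĉ _ (hON z hz) i
        have h3 : ContDiffAt ℝ k (Ĉ i ∘ φ.symm) z :=
          (contMDiffWithinAt_iff_contDiffWithinAt.mp h2).contDiffAt (hOr z hz)
        exact ContDiffAt.comp (f := Prod.fst) (z, q) h3 contDiffAt_fst
      have h4 : ∀ i, ContDiffAt ℝ k (fun pq : E × E ↦ b.repr pq.2 i) (z, q) := fun i ↦
        (((b.coord i).toContinuousLinearMap).contDiff.comp contDiff_snd).contDiffAt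
      exact (ContDiffAt.sum fun i _ ↦ (h4 i).smul ((h1 i).clm_apply contDiffAt_snd)).neg
    exact contDiffAt_snd.prodMk hG
  have hU : IsOpen (O ×ˢ (univ : Set E)) := hO.prod isOpen_univ
  have hFU : ContDiffOn ℝ k F (O ×ˢ (univ : Set E)) := fun pq hpq ↦
    (hF pq.1 hpq.1 pq.2).contDiffWithinAt
  -- the local flow around `z₀`, `C^k` in the initial value and the time
  set z₀ : E × E := (φ x₁, (e₁ p₀).2) with hz₀_def
  have hz₀U : z₀ ∈ O ×ˢ (univ : Set E) := ⟨hxO, mem_univ _⟩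
  obtain ⟨fl, r, hr, ε, hε, hfl0, hfld, hflU, hfls⟩ :=
    Literature.Analysis.ODE.exists_contDiffOn_flow (n := k) hU hFU (by exact_mod_cast hk) hz₀U
  -- the neighbourhood of `p₀`: points whose chart coordinates lie in the ball
  set Z : TangentBundle I M → E × E := fun p ↦ (φ p.proj, (e₁ p).2) with hZ_def
  have hp₀ : p₀ ∈ e₁.source := by
    rw [e₁.mem_source, he₁_def, TangentBundle.trivializationAt_baseSet]
    exact mem_chart_source H p₀.proj
  have hZc : ContinuousOn Z e₁.source := by
    refine ContinuousOn.prodMk ?_ ?_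
    · refine (continuousOn_extChartAt x₁).comp (FiberBundle.continuous_proj E _).continuousOn ?_
      intro p hp
      rw [extChartAt_source]
      simpa [he₁_def] using e₁.mem_source.1 hp
    · exact continuous_snd.comp_continuousOn e₁.continuousOn
  have hZ₀ : Z p₀ = z₀ := rfl
  set 𝒰 : Set (TangentBundle I M) := e₁.source ∩ Z ⁻¹' ball z₀ r with h𝒰_def
  have h𝒰o : IsOpen 𝒰 := hZc.isOpen_inter_preimage e₁.open_source isOpen_ball
  have hp₀𝒰 : p₀ ∈ 𝒰 := ⟨hp₀, by rw [mem_preimage, hZ₀]; exact mem_ball_self hr⟩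
  -- the family of geodesics
  set Γ : TangentBundle I M → ℝ → M := fun p t ↦ φ.symm (fl (Z p) t).1 with hΓ_def
  have hsol : ∀ p ∈ 𝒰, IsGeodesicOn cov (Γ p) (Ioo (-ε) ε) ∧
      ∀ t ∈ Ioo (-ε) ε, (e₁ (tangentLift I (Γ p) t)).2 = (fl (Z p) t).2 := by
    intro p hp
    have hfd : ∀ t ∈ Ioo (-ε) ε, HasDerivAt (fl (Z p)) (F (fl (Z p) t)) t := fun t ht ↦
      hfld (Z p) hp.2 t ht
    exact isGeodesicOn_of_chartSolution (cov := cov) b (hN₁N.trans hNs) Ĉ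
      (fun y hy i w ↦ hĈ y (hN₁N hy) i w) hO hOt hON hOr isOpen_Ioo hfd
      (fun t ht ↦ (hflU (Z p) hp.2 t ht).1)
  have hproj : ∀ p ∈ 𝒰, p.proj ∈ (chartAt H x₁).source := fun p hp ↦ by
    simpa [he₁_def] using e₁.mem_source.1 hp.1
  have hlift0 : ∀ p ∈ 𝒰, tangentLift I (Γ p) 0 = p := by
    intro p hp
    have h0 : (0 : ℝ) ∈ Ioo (-ε) ε := ⟨by linarith, hε⟩
    have hf0 : fl (Z p) 0 = Z p := hfl0 (Z p) hp.2
    have hγ0 : Γ p 0 = p.proj := by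
      show φ.symm (fl (Z p) 0).1 = p.proj
      rw [hf0]
      exact φ.left_inv (by rw [hφ_def, extChartAt_source]; exact hproj p hp)
    refine eq_of_trivializationAt_snd_eq (x₁ := x₁)
      (by simpa only [tangentLift_proj] using hγ0 ▸ hproj p hp) hγ0 ?_
    rw [(hsol p hp).2 0 h0, hf0]
  have hbase : ∀ p ∈ 𝒰, ∀ t ∈ Ioo (-ε) ε, Γ p t ∈ (chartAt H x₁).source := by
    intro p hp t ht
    rw [← extChartAt_source I]
    exact φ.map_target (hOt (hflU (Z p) hp.2 t ht).1)
  have hsrc : ∀ p ∈ 𝒰, ∀ t ∈ Ioo (-ε) ε, tangentLift I (Γ p) t ∈ e₁.source := by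
    intro p hp t ht
    rw [e₁.mem_source, he₁_def, TangentBundle.trivializationAt_baseSet]
    exact hbase p hp t ht
  have hrepr : ∀ p ∈ 𝒰, ∀ t ∈ Ioo (-ε) ε,
      e₁ (tangentLift I (Γ p) t) = (Γ p t, (fl (Z p) t).2) := by
    intro p hp t ht
    refine Prod.ext ?_ ((hsol p hp).2 t ht)
    rw [e₁.coe_fst (hsrc p hp t ht)]
    rfl
  -- the extended chart of `TM` at `p₀` is `Z` on `e₁.source`
  have hchart : ∀ q ∈ e₁.source, extChartAt I.tangent p₀ q = Z q := by
    intro q hq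
    rw [FiberBundle.extChartAt]
    show (φ (e₁ q).1, (e₁ q).2) = (φ q.proj, (e₁ q).2)
    rw [e₁.coe_fst hq]
  have hchart_src : ∀ q ∈ e₁.source, q ∈ (extChartAt I.tangent p₀).source := by
    intro q hq
    rw [FiberBundle.extChartAt, PartialEquiv.trans_source, PartialEquiv.prod_source,
      PartialEquiv.refl_source, mem_inter_iff, mem_preimage]
    refine ⟨hq, ?_, mem_univ _⟩
    show (e₁ q).1 ∈ (extChartAt I p₀.proj).source
    rw [e₁.coe_fst hq, extChartAt_source]
    have h := e₁.mem_source.1 hq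
    rwa [he₁_def, TangentBundle.trivializationAt_baseSet] at h
  refine ⟨𝒰, h𝒰o, hp₀𝒰, ε, hε, Γ, fun p hp ↦ ⟨(hsol p hp).1, hlift0 p hp⟩, ?_⟩
  -- smoothness, read in the charts at `(p₀, 0)` and `p₀`
  have hsub : 𝒰 ×ˢ Ioo (-ε) ε ⊆ (extChartAt (I.tangent.prod 𝓘(ℝ, ℝ)) (p₀, (0 : ℝ))).source := by
    rw [extChartAt_prod, PartialEquiv.prod_source]
    exact prod_mono (fun q hq ↦ hchart_src q hq.1) (by
      rw [extChartAt_source]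
      exact subset_univ _ |>.trans (by simp))
  have hmaps : MapsTo (fun q : TangentBundle I M × ℝ ↦ tangentLift I (Γ q.1) q.2)
      (𝒰 ×ˢ Ioo (-ε) ε) (extChartAt I.tangent p₀).source :=
    fun q hq ↦ hchart_src _ (hsrc q.1 hq.1 q.2 hq.2)
  rw [contMDiffOn_iff_of_subset_source' hsub hmaps]
  -- the written-in-charts map is the flow `fl`
  have hfls' : ContDiffOn ℝ k (fun w : (E × E) × ℝ ↦ fl w.1 w.2)
      ((extChartAt (I.tangent.prod 𝓘(ℝ, ℝ)) (p₀, (0 : ℝ))) '' (𝒰 ×ˢ Ioo (-ε) ε)) := by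
    refine hfls.mono ?_
    rintro _ ⟨⟨q, t⟩, hqt, rfl⟩
    rw [extChartAt_prod, PartialEquiv.prod_coe, extChartAt_model_space_eq_id]
    show (extChartAt I.tangent p₀ q, t) ∈ ball z₀ r ×ˢ Ioo (-ε) ε
    rw [hchart q hqt.1.1]
    exact ⟨hqt.1.2, hqt.2⟩
  refine hfls'.congr ?_
  rintro _ ⟨⟨q, t⟩, hqt, rfl⟩
  have hq : q ∈ 𝒰 := hqt.1
  have ht : t ∈ Ioo (-ε) ε := hqt.2
  rw [extChartAt_prod, extChartAt_model_space_eq_id]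
  show extChartAt I.tangent p₀ (tangentLift I (Γ ((extChartAt I.tangent p₀).symm
      (extChartAt I.tangent p₀ q))) t) = fl (extChartAt I.tangent p₀ q) t
  rw [(extChartAt I.tangent p₀).left_inv (hchart_src q hq.1), hchart _ (hsrc q hq t ht),
    hchart q hq.1]
  -- `Z (tangentLift (Γ q) t) = fl (Z q) t`
  show (φ (tangentLift I (Γ q) t).proj, (e₁ (tangentLift I (Γ q) t)).2) = fl (Z q) t
  rw [hrepr q hq t ht]
  refine Prod.ext ?_ rfl
  show φ (Γ q t) = (fl (Z q) t).1
  exact φ.right_inv (hOt (hflU (Z q) hq.2 t ht).1)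


/-! ### Complete connections: the geodesic flow `(p, t) ↦ (γ_p t, γ_p' t)` is `C^k` -/

section Complete

open Literature.Geometry.Riemannian

variable [CompleteSpace E] [T2Space M] [BoundarylessManifold I M]
  [CovariantDerivative.ContMDiffCovariantDerivative cov 1]

/-- **Local `C^k`-smoothness of the geodesic flow of a complete connection** (Lee 2018,
Thm. 4.27 (d) / Prop. 5.19; O'Neill 1983, Ch. 3, p. 70): for a complete connection of class `C^k`
and `C¹` (`1 ≤ k < ∞`) every `p₀ ∈ TM` has an open neighbourhood `𝒰` and an `ε > 0` such that
`(q, t) ↦ (γ_q t, γ_q' t)` is `C^k` on `𝒰 × (-ε, ε)` — the local `C^k` family of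
`exists_nhds_contMDiffOn_isGeodesicOn` agrees with the maximal geodesics by uniqueness.
[cite: LeeRiemannianManifolds2018, Prop. 5.19] -/
theorem exists_isOpen_contMDiffOn_tangentLift_maximalGeodesic (hc : IsGeodesicallyComplete cov)
    (k : ℕ) (hk : 1 ≤ k) [CovariantDerivative.ContMDiffCovariantDerivative cov k]
    (p₀ : TangentBundle I M) :
    ∃ 𝒰 : Set (TangentBundle I M), IsOpen 𝒰 ∧ p₀ ∈ 𝒰 ∧ ∃ ε > (0 : ℝ),
      ContMDiffOn (I.tangent.prod 𝓘(ℝ, ℝ)) I.tangent k (fun q : TangentBundle I M × ℝ ↦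
        tangentLift I (maximalGeodesic cov q.1.proj q.1.snd) q.2) (𝒰 ×ˢ Ioo (-ε) ε) := by
  obtain ⟨𝒰, h𝒰o, hp₀, ε, hε, Γ, hΓ, hsmooth⟩ :=
    exists_nhds_contMDiffOn_isGeodesicOn (cov := cov) k hk p₀ BoundarylessManifold.isInteriorPoint
  refine ⟨𝒰, h𝒰o, hp₀, ε, hε, hsmooth.congr fun q hq ↦ ?_⟩
  obtain ⟨hgeo, h0⟩ := hΓ q.1 hq.1
  obtain ⟨hmax, hx, hv⟩ := isGeodesic_maximalGeodesic hc q.1.proj q.1.snd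
  have heqOn : EqOn (maximalGeodesic cov q.1.proj q.1.snd) (Γ q.1) (Ioo (-ε) ε) :=
    IsGeodesicOn.eqOn_of_velocity_eq_holds isOpen_Ioo Set.ordConnected_Ioo (hmax.isGeodesicOn _)
      hgeo (t₀ := 0) ⟨by linarith, hε⟩ (hx.trans (apply_eq_proj_of_tangentLift_eq h0).symm)
      (hv.trans (velocity_eq_snd_of_tangentLift_eq h0).symm)
  exact tangentLift_congr_of_eventuallyEq
    (Filter.eventuallyEq_of_mem (isOpen_Ioo.mem_nhds hq.2) heqOn)

/-- For small times the time-`t` map `q ↦ (γ_q t, γ_q' t)` is `C^k` at every point of a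
neighbourhood of `p₀`, with a locally uniform time. [cite: LeeRiemannianManifolds2018, Prop. 5.19] -/
theorem exists_isOpen_forall_contMDiffAt_tangentLift_maximalGeodesic
    (hc : IsGeodesicallyComplete cov) (k : ℕ) (hk : 1 ≤ k)
    [CovariantDerivative.ContMDiffCovariantDerivative cov k] (p₀ : TangentBundle I M) :
    ∃ 𝒰 : Set (TangentBundle I M), IsOpen 𝒰 ∧ p₀ ∈ 𝒰 ∧ ∃ ε > (0 : ℝ), ∀ t ∈ Ioo (-ε) ε,
      ∀ q ∈ 𝒰, ContMDiffAt I.tangent I.tangent k (fun q' : TangentBundle I M ↦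
        tangentLift I (maximalGeodesic cov q'.proj q'.snd) t) q := by
  obtain ⟨𝒰, h𝒰o, hp₀, ε, hε, hsmooth⟩ :=
    exists_isOpen_contMDiffOn_tangentLift_maximalGeodesic hc k hk p₀
  refine ⟨𝒰, h𝒰o, hp₀, ε, hε, fun t ht q hq ↦ ?_⟩
  have h1 : ContMDiffAt (I.tangent.prod 𝓘(ℝ, ℝ)) I.tangent k (fun q' : TangentBundle I M × ℝ ↦
      tangentLift I (maximalGeodesic cov q'.1.proj q'.1.snd) q'.2) (q, t) :=
    hsmooth.contMDiffAt ((h𝒰o.prod isOpen_Ioo).mem_nhds ⟨hq, ht⟩)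
  have h2 : ContMDiffAt I.tangent (I.tangent.prod 𝓘(ℝ, ℝ)) k
      (fun q' : TangentBundle I M ↦ ((q', t) : TangentBundle I M × ℝ)) q :=
    contMDiffAt_id.prodMk contMDiffAt_const
  exact ContMDiffAt.comp (f := fun q' : TangentBundle I M ↦ ((q', t) : TangentBundle I M × ℝ))
    (g := fun q' : TangentBundle I M × ℝ ↦
      tangentLift I (maximalGeodesic cov q'.1.proj q'.1.snd) q'.2) q h1 h2

/-- **`C^k`-smoothness of the geodesic flow for all times on a compact invariant set** (Lee 2018,
Thm. 4.27 (d) / Prop. 5.19: the geodesic flow is smooth on its domain — here the part needed on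
compact flow-invariant sets, e.g. the sphere bundles of a compact Riemannian manifold). Let `cov`
be a complete connection of class `C^k` and `C¹` and `K ⊆ TM` compact and invariant under the
geodesic flow. Then for every `t` the map `q ↦ (γ_q t, γ_q' t)` is `C^k` at every point of `K`:
a uniform small time by compactness, then `Φ_t` is an iterate of short-time maps (flow property),
each `C^k` at the relevant points by invariance. [cite: LeeRiemannianManifolds2018, Prop. 5.19] -/
theorem contMDiffAt_tangentLift_maximalGeodesic_of_isCompact (hc : IsGeodesicallyComplete cov)
    (k : ℕ) (hk : 1 ≤ k) [CovariantDerivative.ContMDiffCovariantDerivative cov k]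
    {K : Set (TangentBundle I M)} (hK : IsCompact K)
    (hinv : ∀ p ∈ K, ∀ t : ℝ, tangentLift I (maximalGeodesic cov p.proj p.snd) t ∈ K) (t : ℝ)
    {p : TangentBundle I M} (hp : p ∈ K) :
    ContMDiffAt I.tangent I.tangent k
      (fun q : TangentBundle I M ↦ tangentLift I (maximalGeodesic cov q.proj q.snd) t) p := by
  classical
  -- a uniform small time on `K`
  obtain ⟨ε₀, hε₀, hunif⟩ : ∃ ε₀ > (0 : ℝ), ∀ u ∈ Ioo (-ε₀) ε₀, ∀ q ∈ K,
      ContMDiffAt I.tangent I.tangent k (fun q' : TangentBundle I M ↦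
        tangentLift I (maximalGeodesic cov q'.proj q'.snd) u) q := by
    choose 𝒰 h𝒰o hmem ε hε hcont using fun p₀ : TangentBundle I M ↦
      exists_isOpen_forall_contMDiffAt_tangentLift_maximalGeodesic hc k hk p₀
    obtain ⟨T, -, hT⟩ := hK.elim_nhds_subcover 𝒰 fun q _ ↦ (h𝒰o q).mem_nhds (hmem q)
    have hTne : T.Nonempty := by
      by_contra h
      rw [Finset.not_nonempty_iff_eq_empty] at h
      have := hT hp
      simp [h] at this
    refine ⟨T.inf' hTne ε, (Finset.lt_inf'_iff hTne).2 fun q _ ↦ hε q, fun u hu q hq ↦ ?_⟩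
    obtain ⟨q₀, hq₀, hqq₀⟩ := mem_iUnion₂.1 (hT hq)
    refine hcont q₀ u ⟨?_, ?_⟩ q hqq₀
    · exact lt_of_le_of_lt (neg_le_neg (Finset.inf'_le ε hq₀)) hu.1
    · exact lt_of_lt_of_le hu.2 (Finset.inf'_le ε hq₀)
  -- `t = N s` with `|s| < ε₀`
  obtain ⟨N, hN⟩ : ∃ N : ℕ, |t| / ε₀ < N := exists_nat_gt _
  have hNpos : (0 : ℝ) < N := lt_of_le_of_lt (div_nonneg (abs_nonneg t) hε₀.le) hN
  have hN0 : (N : ℝ) ≠ 0 := hNpos.ne'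
  set s : ℝ := t / N with hs_def
  have hs : s ∈ Ioo (-ε₀) ε₀ := by
    have h1 : |t| < N * ε₀ := by
      have := (div_lt_iff₀ hε₀).1 hN
      linarith
    have h2 : |s| < ε₀ := by
      rw [hs_def, abs_div, abs_of_pos hNpos, div_lt_iff₀ hNpos]
      linarith
    exact ⟨by linarith [neg_abs_le s, h2], lt_of_le_of_lt (le_abs_self s) h2⟩
  -- induction on the number of steps
  have hstep : ∀ m : ℕ, ∀ q ∈ K, ContMDiffAt I.tangent I.tangent k (fun q' : TangentBundle I M ↦
      tangentLift I (maximalGeodesic cov q'.proj q'.snd) (m * s)) q := by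
    intro m
    induction m with
    | zero =>
      intro q hq
      have h0 : ((0 : ℕ) : ℝ) * s ∈ Ioo (-ε₀) ε₀ := by
        simp only [Nat.cast_zero, zero_mul]
        exact ⟨by linarith, hε₀⟩
      exact hunif _ h0 q hq
    | succ m ih =>
      intro q hq
      have hfun : (fun q' : TangentBundle I M ↦
          tangentLift I (maximalGeodesic cov q'.proj q'.snd) ((m + 1 : ℕ) * s)) =
          (fun q' : TangentBundle I M ↦
            tangentLift I (maximalGeodesic cov q'.proj q'.snd) (m * s)) ∘
          fun q' : TangentBundle I M ↦ tangentLift I (maximalGeodesic cov q'.proj q'.snd) s := by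
        funext q'
        simp only [Function.comp_apply, Nat.cast_succ, add_mul, one_mul]
        exact tangentLift_maximalGeodesic_add hc q' s (m * s)
      rw [hfun]
      exact ContMDiffAt.comp q (ih _ (hinv q hq s)) (hunif s hs q hq)
  have ht : t = N * s := by
    rw [hs_def, mul_div_cancel₀ t hN0]
  rw [ht]
  exact hstep N p hp

/-- Base-point form of `contMDiffAt_tangentLift_maximalGeodesic_of_isCompact`: on a compact set of
`TM` invariant under the geodesic flow of a complete `C^k` (and `C¹`) connection, `q ↦ γ_q t` is
`C^k` at every point of the set, for every `t` (the bundle projection is smooth).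
[cite: LeeRiemannianManifolds2018, Prop. 5.19] -/
theorem contMDiffAt_maximalGeodesic_of_isCompact (hc : IsGeodesicallyComplete cov)
    (k : ℕ) (hk : 1 ≤ k) [CovariantDerivative.ContMDiffCovariantDerivative cov k]
    {K : Set (TangentBundle I M)} (hK : IsCompact K)
    (hinv : ∀ p ∈ K, ∀ t : ℝ, tangentLift I (maximalGeodesic cov p.proj p.snd) t ∈ K) (t : ℝ)
    {p : TangentBundle I M} (hp : p ∈ K) :
    ContMDiffAt I.tangent I k (fun q : TangentBundle I M ↦ maximalGeodesic cov q.proj q.snd t) p :=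
  ((Bundle.contMDiff_proj (TangentSpace I : M → Type _)).of_le le_top).contMDiffAt.comp p
    (contMDiffAt_tangentLift_maximalGeodesic_of_isCompact hc k hk hK hinv t hp)


/-! ### The exponential map is `C^k` -/

omit [FiniteDimensional ℝ E] [CompleteSpace E] [T2Space M] [BoundarylessManifold I M]
  [CovariantDerivative.ContMDiffCovariantDerivative cov 1] in
/-- The inclusion `v ↦ (x, v)` of a fibre into the tangent bundle is smooth (in the trivialisation
at `x` it is the continuous linear map `v ↦ (e (x, v)).2`). [folklore] -/
theorem contMDiff_totalSpaceMk (m : ℕ∞ω) (x : M) :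
    ContMDiff 𝓘(ℝ, E) I.tangent m (fun v : E ↦ (TotalSpace.mk' E x v : TangentBundle I M)) := by
  intro v
  rw [Bundle.contMDiffAt_totalSpace]
  refine ⟨contMDiffAt_const, ?_⟩
  set e := trivializationAt E (TangentSpace I : M → Type _) x with he_def
  have hx : x ∈ e.baseSet := FiberBundle.mem_baseSet_trivializationAt' x
  set L : E →L[ℝ] E := e.continuousLinearMapAt ℝ x with hL_def
  have heq : (fun w : E ↦ (e (TotalSpace.mk' E x w)).2) = fun w ↦ L w := by
    funext w
    exact (Trivialization.continuousLinearMapAt_apply_of_mem ℝ e hx w).symm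
  show ContMDiffAt 𝓘(ℝ, E) 𝓘(ℝ, E) m (fun w : E ↦ (e (TotalSpace.mk' E x w)).2) v
  rw [heq]
  exact L.contMDiff.contMDiffAt

/-- **The exponential map of a complete connection is `C^k` at every vector lying in a compact
flow-invariant subset of `TM`** (Lee 2018, Prop. 5.19: `exp` is smooth; O'Neill 1983, Ch. 3,
Prop. 28 ff.). For `cov` complete of class `C^k` and `C¹`, `K ⊆ TM` compact and invariant, and
`(x, v) ∈ K`: `w ↦ exp_x(w) = γ_{(x,w)}(1)` is `C^k` at `v` (the fibre inclusion is smooth,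
`contMDiff_totalSpaceMk`, and `q ↦ γ_q(1)` is `C^k` at `(x, v)`,
`contMDiffAt_maximalGeodesic_of_isCompact`; on a complete connection `exp_x(w) = γ_{(x,w)}(1)` for
all `w`, `expDomain_eq_univ`). On a compact Riemannian manifold every `(x, v)` lies in such a `K`
(the sphere bundle through it). [cite: LeeRiemannianManifolds2018, Prop. 5.19] -/
theorem contMDiffAt_expMap_of_isCompact (hc : IsGeodesicallyComplete cov) (k : ℕ) (hk : 1 ≤ k)
    [CovariantDerivative.ContMDiffCovariantDerivative cov k] {K : Set (TangentBundle I M)}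
    (hK : IsCompact K)
    (hinv : ∀ p ∈ K, ∀ t : ℝ, tangentLift I (maximalGeodesic cov p.proj p.snd) t ∈ K)
    {x : M} {v : E} (hv : (TotalSpace.mk' E x v : TangentBundle I M) ∈ K) :
    ContMDiffAt 𝓘(ℝ, E) I k (fun w : E ↦ expMap cov x (show TangentSpace I x from w)) v := by
  have hfun : (fun w : E ↦ expMap cov x (show TangentSpace I x from w)) =
      (fun q : TangentBundle I M ↦ maximalGeodesic cov q.proj q.snd 1) ∘
        fun w : E ↦ (TotalSpace.mk' E x w : TangentBundle I M) := by
    funext w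
    simp only [Function.comp_apply]
    exact expMap_of_mem (by rw [expDomain_eq_univ hc x]; exact mem_univ _)
  rw [hfun]
  exact ContMDiffAt.comp v (contMDiffAt_maximalGeodesic_of_isCompact hc k hk hK hinv 1 hv)
    (contMDiff_totalSpaceMk (k : ℕ∞ω) x v)

end Complete

end Literature.Geometry.Lorentzian

end
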